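import Summits.QuantumFields.GaugeBoot.TiltedLatticeAxisFlip
import HarnessLib

/-!
# An axis flip that moves a link is not a reflection of positive type (gauge-boot, L3 negative supplement, part 1)

HONEST FRAMING (cell `pub-gaugeboot`, page 1 of every file): the venture produces certified bounds
on lattice expectations at stated coupling, gauge group, dimension and torus size; NOT a mass gap,
NOT a continuum limit, NOT a string tension; NOT Yang–Mills-summit-bearing (barriers
`FixedCouplingUltralocality`, `PerturbativeInvisibility`). This module is a small NEGATIVE tool about
which positivity blocks a certificate on a periodic lattice may use; it discharges nothing else.

In the periodic-lattice setting of `TiltedLatticeGauge.lean` (finite additive site group `A`,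
translations `e`; Wilson measure `μ_β = gibbs ρ e β`):

* **`integral_sq_gibbs_pos`** — `0 < ∫ h² dμ_β` for a bounded measurable real `h` that does not
  vanish on a non-empty open set of configurations (every real `β`): the Boltzmann weight is bounded
  below (`boltzmann_bounds`) and the product Haar measure charges non-empty open sets. This is the
  periodic-lattice form of `integral_exp_mul_sq_pos` of `DiagonalRPTorusNegative.lean`.
* **`IsAxisFlip.exists_integral_conj_mul_neg`** — for an axis flip `σ` along `k` (`IsAxisFlip`,
  `TiltedLatticeAxisFlip.lean`), `Θ = configReflect e k σ` the induced reflection of configurations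
  (`k`-links reversed and inverted, other links carried along) and a link `(x, m)`, `m ≠ k`, whose
  base point is MOVED (`σ x ≠ x`): the two-link observable `F(U) = g(U(x, m)) - g(U(σx, m))`
  (`g : G → [0, 1]` continuous separating two points) is odd under `Θ`, so
  `∫ conj F(ΘU) · F(U) dμ_β = -∫ F² dμ_β < 0` at EVERY real `β` (non-trivial compact Hausdorff second
  countable `G`, continuous `ρ`). Hence no class of "half observables" containing such a pair of
  links is reflection positive for `Θ`: a closed half bounded by a `σ`-invariant layer works only
  if the layer is POINTWISE fixed (the axiom `fix_of_layer` of the tree's frames). Used in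
  `TiltedBoxAxisRPNegative.lean` for the in-plane axes of the 45°-tilted box.

References: J. Fröhlich, R. Israel, E. H. Lieb, B. Simon, J. Stat. Phys. 22 (1980) 297, §3;
K. Osterwalder, E. Seiler, Ann. Phys. 110 (1978) 440, §2.
-/

noncomputable section

open MeasureTheory Complex
open scoped ComplexOrder ComplexConjugate
open Literature.MathematicalPhysics.QuantumFieldTheory (haarProbability)
open Literature.RepresentationTheory.CompactGroups

namespace Summit.QuantumFields.GaugeBoot

namespace TiltedRP

/-! ## Strict positivity of `∫ h² dμ_β` and the abstract two-link negative -/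

section Abstract

variable {A : Type*} [AddCommGroup A] [Fintype A] {d N : ℕ} {G : Type*} [Group G]
  [TopologicalSpace G] [IsTopologicalGroup G] [CompactSpace G] [MeasurableSpace G] [BorelSpace G]
  [SecondCountableTopology G]
variable (ρ : G →* Matrix (Fin N) (Fin N) ℂ)

/-- **Strict positivity of `∫ h² dμ_β`** on any periodic lattice, for a bounded measurable real `h`
that does not vanish on some non-empty open set of configurations: the Boltzmann weight is bounded
below (`boltzmann_bounds`) and the product Haar measure charges non-empty open sets. -/
theorem integral_sq_gibbs_pos (hρ : Continuous ρ) (e : Fin d → A) (β : ℝ) {h : Config A d G → ℝ}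
    (hh : Measurable h) {C : ℝ} (hC : ∀ U, |h U| ≤ C) {O : Set (Config A d G)} (hO : IsOpen O)
    (hOne : O.Nonempty) (hOh : ∀ U ∈ O, h U ≠ 0) :
    0 < ∫ U, h U ^ 2 ∂(gibbs ρ e β) := by
  haveI := isProbabilityMeasure_productHaar (A := A) (d := d) (G := G)
  haveI : IsProbabilityMeasure (haarProbability G) :=
    CompactGroup.isProbabilityMeasure_haarMeasure_top
  haveI : (haarProbability G).IsOpenPosMeasure := by
    unfold haarProbability; infer_instance
  haveI : (productHaar A d G).IsOpenPosMeasure := by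
    unfold productHaar; infer_instance
  rw [integral_gibbs]
  set π := productHaar A d G with hπ
  set Z := ∫ U, Real.exp (-β * wilsonAction ρ e U) ∂π with hZ
  have hZpos : 0 < Z := normaliser_pos ρ hρ e β
  set c := Real.exp (-(|β| * (2 * N * Fintype.card (Plaq A d)))) with hc
  have hcpos : 0 < c := Real.exp_pos _
  have hsqC : ∀ U, h U ^ 2 ≤ C ^ 2 := fun U => by
    rw [← sq_abs]; exact pow_le_pow_left₀ (abs_nonneg _) (hC U) 2
  have hsq_int : Integrable (fun U => h U ^ 2) π := by
    refine Integrable.of_bound (hh.pow_const 2).aestronglyMeasurable (C ^ 2)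
      (ae_of_all _ fun U => ?_)
    rw [Real.norm_eq_abs, abs_of_nonneg (sq_nonneg _)]
    exact hsqC U
  have hw_int : Integrable (fun U => (Real.exp (-β * wilsonAction ρ e U) / Z) • h U ^ 2) π := by
    refine Integrable.of_bound
      ((((continuous_boltzmann ρ hρ e β).measurable.div_const Z).smul (hh.pow_const 2))
        |>.aestronglyMeasurable)
      (Real.exp (|β| * (2 * N * Fintype.card (Plaq A d))) / Z * C ^ 2) (ae_of_all _ fun U => ?_)
    rw [smul_eq_mul, Real.norm_eq_abs,
      abs_of_nonneg (mul_nonneg (div_nonneg (Real.exp_nonneg _) hZpos.le) (sq_nonneg _))]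
    exact mul_le_mul (div_le_div_of_nonneg_right (boltzmann_bounds ρ hρ e β U).2 hZpos.le)
      (hsqC U) (sq_nonneg _) (by positivity)
  have hsq_pos : 0 < ∫ U, h U ^ 2 ∂π := by
    rw [integral_pos_iff_support_of_nonneg (fun U => sq_nonneg (h U)) hsq_int]
    have hOsupp : O ⊆ Function.support fun U => h U ^ 2 := fun U hU => by
      rw [Function.mem_support]; exact pow_ne_zero 2 (hOh U hU)
    exact lt_of_lt_of_le (hO.measure_pos π hOne) (measure_mono hOsupp)
  calc (0 : ℝ) < c / Z * ∫ U, h U ^ 2 ∂π := mul_pos (div_pos hcpos hZpos) hsq_pos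
    _ = ∫ U, c / Z * h U ^ 2 ∂π := (integral_const_mul _ _).symm
    _ ≤ ∫ U, (Real.exp (-β * wilsonAction ρ e U) / Z) • h U ^ 2 ∂π := by
        refine integral_mono (hsq_int.const_mul _) hw_int fun U => ?_
        show c / Z * h U ^ 2 ≤ (Real.exp (-β * wilsonAction ρ e U) / Z) • h U ^ 2
        rw [smul_eq_mul]
        exact mul_le_mul_of_nonneg_right
          (div_le_div_of_nonneg_right (boltzmann_bounds ρ hρ e β U).1 hZpos.le) (sq_nonneg _)

/-- **Axis RP fails as soon as a layer link is moved** (any periodic lattice, every coupling). Let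
`σ` be an axis flip along `k`, `Θ = configReflect e k σ` the induced reflection of configurations
(`k`-links reversed and inverted, other links carried along), and `(x, m)` a link with `m ≠ k` whose
base point is NOT fixed, `σ x ≠ x`. For non-trivial compact Hausdorff second countable `G`,
continuous `ρ` and EVERY real `β` there is a measurable `F`, `‖F‖ ≤ 1`, depending only on the two
link variables `U(x, m)`, `U(σx, m)`, odd under `Θ` (`F ∘ Θ = -F`), with
`∫ conj F(ΘU) · F(U) dμ_β = -∫ |F|² dμ_β < 0` (a real negative number). Witness:
`F(U) = g(U(x, m)) - g(U(σx, m))`, `g : G → [0, 1]` continuous separating two points. -/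
theorem IsAxisFlip.exists_integral_conj_mul_neg [Nontrivial G] [T2Space G] {e : Fin d → A}
    {k : Fin d} {σ : A →+ A} (hF : IsAxisFlip e k σ) (hρ : Continuous ρ) (β : ℝ) {x : A}
    {m : Fin d} (hm : m ≠ k) (hx : σ x ≠ x) :
    ∃ F : Config A d G → ℂ, Measurable F ∧ (∀ U, ‖F U‖ ≤ 1) ∧
      (∀ U V : Config A d G, U (x, m) = V (x, m) → U (σ x, m) = V (σ x, m) → F U = F V) ∧
      (∀ U, F (configReflect e k σ U) = -F U) ∧
      ∫ U, conj (F (configReflect e k σ U)) * F U ∂(gibbs ρ e β) < 0 := by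
  classical
  obtain ⟨a, b, hab⟩ := exists_pair_ne G
  obtain ⟨g, hga, hgb, hg01⟩ := exists_continuous_zero_one_of_isClosed
    (isClosed_singleton (x := a)) (isClosed_singleton (x := b)) (Set.disjoint_singleton.2 hab)
  have hne : ((x, m) : Link A d) ≠ (σ x, m) := fun h' => hx (Prod.ext_iff.1 h').1.symm
  set h : Config A d G → ℝ := fun U => g (U (x, m)) - g (U (σ x, m)) with hh
  have hh_meas : Measurable h :=
    (g.continuous.measurable.comp (measurable_pi_apply _)).sub
      (g.continuous.measurable.comp (measurable_pi_apply _))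
  have hh_bound : ∀ U, |h U| ≤ 1 := fun U => by
    rw [hh, abs_sub_le_iff]
    constructor <;> linarith [(hg01 (U (x, m))).1, (hg01 (U (x, m))).2, (hg01 (U (σ x, m))).1,
      (hg01 (U (σ x, m))).2]
  have hh_odd : ∀ U, h (configReflect e k σ U) = -h U := fun U => by
    simp only [hh, configReflect_other e k σ U _ hm, hF.invol]
    ring
  refine ⟨fun U => (h U : ℂ), Complex.measurable_ofReal.comp hh_meas, fun U => ?_,
    fun U V h1 h2 => ?_, fun U => ?_, ?_⟩
  · rw [Complex.norm_real, Real.norm_eq_abs]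
    exact hh_bound U
  · simp only [hh, h1, h2]
  · show ((h (configReflect e k σ U) : ℝ) : ℂ) = -((h U : ℝ) : ℂ)
    rw [hh_odd]
    push_cast
    ring
  · have hint : (fun U => conj ((h (configReflect e k σ U) : ℝ) : ℂ) * (h U : ℂ)) =
        fun U => ((-(h U ^ 2) : ℝ) : ℂ) := by
      funext U
      rw [Complex.conj_ofReal, hh_odd]
      push_cast
      ring
    rw [hint, integral_complex_ofReal, ← Complex.ofReal_zero, Complex.real_lt_real, integral_neg,
      neg_lt_zero]
    set O : Set (Config A d G) :=
      (fun U : Config A d G => U (x, m)) ⁻¹' (g ⁻¹' Set.Iio (1 / 2 : ℝ)) ∩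
        (fun U : Config A d G => U (σ x, m)) ⁻¹' (g ⁻¹' Set.Ioi (1 / 2 : ℝ)) with hOdef
    have hO : IsOpen O :=
      ((isOpen_Iio.preimage g.continuous).preimage (continuous_apply _)).inter
        ((isOpen_Ioi.preimage g.continuous).preimage (continuous_apply _))
    have hOne : O.Nonempty := by
      refine ⟨Function.update (fun _ => a) (σ x, m) b, ?_, ?_⟩
      · simp only [Set.mem_preimage, Function.update_of_ne hne, hga rfl, Set.mem_Iio]; norm_num
      · simp only [Set.mem_preimage, Function.update_self, hgb rfl, Set.mem_Ioi]; norm_num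
    have hOh : ∀ U ∈ O, h U ≠ 0 := by
      rintro U ⟨h1, h2⟩
      simp only [Set.mem_preimage, Set.mem_Iio, Set.mem_Ioi] at h1 h2
      show g (U (x, m)) - g (U (σ x, m)) ≠ 0
      exact (by linarith : g (U (x, m)) - g (U (σ x, m)) < 0).ne
    exact integral_sq_gibbs_pos ρ hρ e β hh_meas hh_bound hO hOne hOh

end Abstract

end TiltedRP

end Summit.QuantumFields.GaugeBoot
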